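import Summits.ResolutionOfSingularities.ResolutionOfSingularities.Theorems.FrobeniusLadderFInjectiveMacaulayficationTowerBedChartCM
import Summits.ResolutionOfSingularities.ResolutionOfSingularities.Theorems.FrobeniusLadderFInjectiveMacaulayficationDiagonalBPCIChartsCM
import Summits.ResolutionOfSingularities.ResolutionOfSingularities.Theorems.FrobeniusLadderFInjectiveMacaulayficationDiagonalBPCIVertexNotFull
import Summits.ResolutionOfSingularities.ResolutionOfSingularities.Theorems.FrobeniusLadderFInjectiveMacaulayficationDiagonalBPCIChart5NotFull
import Summits.ResolutionOfSingularities.ResolutionOfSingularities.Theorems.FrobeniusLadderFInjectiveMacaulayficationDiagonalCIPair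
import HarnessLib

/-!
# ROW #13 / BED CI-3, FLOOR NOT-FULL COLUMN: the `x₅`-chart of `Bl_𝔪 X`, `X = V(x₀²+x₁³+x₂⁵+x₃⁵+x₄⁷+x₅⁷, x₀²+2x₁³+x₂¹⁰+x₃¹⁰+x₄¹⁴+x₅¹⁴)`, carries a point over the vertex that is NOT FULL — p-UNIFORMLY
# (crux `FInjectiveMacaulayfication` stmt-ResolutionOfSingularities-15315, chain w45a; res-L1-w45a-plan-1 RULINGs R23.25 (β) / R23.29; seat res-L1-w45a-stub-2 g13, option (α′) «make ROW #13
# two-sided»: the combinations `P = 2F₀ − F₁ = x₀² − G`, `Q = F₁ − F₀ = x₁³ + H` have the BED CI-1 tower shape, so ✓`DiagonalBPCIChart5NotFull` ports)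

[OURS · L1 W4.5a] Support file (`--supports stmt-ResolutionOfSingularities-15315 --as helper`); def-free; UNCONDITIONAL; no named fact, no sorry; a census certificate on ONE bed; NOT a
statement of any manuscript. AI-written (AI review weaker than expert review).

THE CHART. `θ₅ : x₅ ↦ y₅, xⱼ ↦ yⱼy₅`; `θ₅P = y₅²·p₁`, `θ₅Q = y₅³·q₁` with
`p₁ = y₀² − (y₂¹⁰y₅⁸ − 2y₂⁵y₅³ + y₃¹⁰y₅⁸ − 2y₃⁵y₅³ + y₄¹⁴y₅¹² − 2y₄⁷y₅⁵ + y₅¹² − 2y₅⁵)`, `q₁ = y₁³ + (y₂¹⁰y₅⁷ − y₂⁵y₅² + y₃¹⁰y₅⁷ − y₃⁵y₅² + y₄¹⁴y₅¹¹ − y₄⁷y₅⁴ + y₅¹¹ − y₅⁴)`.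
* §1 chart identities (`theta_PQ`, `theta_F_mem`, `constantCoeff_g`; `PQ_mem` is ✓`DiagonalBPCIChart5NotFull.PQ_mem`);
* §2 `no_square_of_spec_trailing`, `isPrime_chart5` — `(p₁, q₁) = (y₀² − ιG₅, y₁³ + ιH₅)` is the monic tower of ✓`MonicTowerPrime` (`G₅ ↦ t¹² − 2t⁵` has odd TRAILING degree `5` when `2 ≠ 0`; `−H₅ ↦ t¹¹ − t⁴`,
  `3 ∤ 11`), hence PRIME with `y₅ ∉` it — it IS the ideal of the strict transform on the chart;
* §3 a small MINIMAL-WEIGHT toolkit (`le_weight_of_mem_support_mul/pow/diag`, `mem_span_X_pow_of_le_weight`, `wge_*`: lower bounds for the weights of the monomials of `X i ^ a`, `X i ^ a * X j ^ b`, `C c * _`, sums, differences) and the p-UNIFORM CI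
  Fedder certificate: with `u = (15, 8, 3, 3, 0, 6)` every monomial of `p₁` weighs `≥ 30`, of `q₁` `≥ 24`, so `(p₁q₁)^{p−1}` weighs `≥ 54(p−1) > 35(p−1) = (p−1)Σuᵢ` and lies in
  `(yᵢ^p)`; the s.o.p. certificate `(y)⁴ ⊆ (p₁, q₁, y₂, y₃, y₄, y₅)`;
* §4 ★★ `twoRatioBP_pointFloor_not_full` (`2 ≠ 0` in `k`) — ONE application of ✓`PointFloorNotFullCI.pointFloor_not_full`.
[cite: Fedder1983, Thm. 1.12 and Prop. 2.1] [cite: GortzWedhorn2020, Prop. 13.91 (2)] [cite: StacksProject, Tag 080E]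
-/

-- single-problem summit: the doubled namespace component is forced
set_option linter.dupNamespace false

noncomputable section

open AlgebraicGeometry MvPolynomial IsLocalRing

namespace Summit.ResolutionOfSingularities.ResolutionOfSingularities.Theorems.FInjectiveMacaulayfication.TwoRatioBPChart5NotFull

open Summit.ResolutionOfSingularities.ResolutionOfSingularities.Theorems.FInjectiveMacaulayfication SliceableCentre
open Literature.AlgebraicGeometry.Resolution

variable (k : Type) [Field k]

/-! ## §1 The chart identities -/


set_option linter.unusedSimpArgs false in
-- one `simp only` set serves both chart identities; not every lemma fires in each case
/-- ★ **The chart identities**: `θ₅(2F₀ − F₁) = y₅²·p₁`, `θ₅(F₁ − F₀) = y₅³·q₁`. [folklore] -/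
theorem theta_PQ (F : Fin 2 → MvPolynomial (Fin 6) k)
    (hF0 : F 0 = X 0 ^ 2 + X 1 ^ 3 + X 2 ^ 5 + X 3 ^ 5 + X 4 ^ 7 + X 5 ^ 7)
    (hF1 : F 1 = X 0 ^ 2 + C 2 * X 1 ^ 3 + X 2 ^ 10 + X 3 ^ 10 + X 4 ^ 14 + X 5 ^ 14)
    (g : Fin 2 → MvPolynomial (Fin 6) k)
    (hg0 : g 0 = X 0 ^ 2 - (X 2 ^ 10 * X 5 ^ 8 - C 2 * (X 2 ^ 5 * X 5 ^ 3) + X 3 ^ 10 * X 5 ^ 8 - C 2 * (X 3 ^ 5 * X 5 ^ 3) + X 4 ^ 14 * X 5 ^ 12 -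
      C 2 * (X 4 ^ 7 * X 5 ^ 5) + X 5 ^ 12 - C 2 * X 5 ^ 5))
    (hg1 : g 1 = X 1 ^ 3 + (X 2 ^ 10 * X 5 ^ 7 - X 2 ^ 5 * X 5 ^ 2 + X 3 ^ 10 * X 5 ^ 7 - X 3 ^ 5 * X 5 ^ 2 + X 4 ^ 14 * X 5 ^ 11 - X 4 ^ 7 * X 5 ^ 4 +
      X 5 ^ 11 - X 5 ^ 4)) : ∀ l : Fin 2,
    aeval (fun j : Fin 6 => if j = 5 then (X 5 : MvPolynomial (Fin 6) k) else X j * X 5) ((![C 2 * F 0 - F 1, F 1 - F 0] : Fin 2 → MvPolynomial (Fin 6) k) l) =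
      X 5 ^ ((![2, 3] : Fin 2 → ℕ) l) * g l := by
  refine Fin.forall_fin_two.mpr ⟨?_, ?_⟩
  · simp only [Matrix.cons_val_zero, hF0, hF1, hg0]
    simp only [map_sub, map_add, map_mul, map_pow, aeval_X, aeval_C, algebraMap_eq, Fin.reduceEq, if_true, if_false, map_ofNat, reduceIte]
    ring
  · simp only [Matrix.cons_val_one, Matrix.cons_val_zero, hF0, hF1, hg1]
    simp only [map_sub, map_add, map_mul, map_pow, aeval_X, aeval_C, algebraMap_eq, Fin.reduceEq, if_true, if_false, map_ofNat, reduceIte]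
    ring

set_option linter.unusedSimpArgs false in
-- one `simp only` set serves both generators; not every lemma fires in each case
/-- **The total transforms lie in the chart ideal**: `θ₅F₀ = y₅²p₁ + y₅³q₁`, `θ₅F₁ = y₅²p₁ + 2y₅³q₁ ∈ (p₁, q₁)`. [folklore] -/
theorem theta_F_mem (F : Fin 2 → MvPolynomial (Fin 6) k)
    (hF0 : F 0 = X 0 ^ 2 + X 1 ^ 3 + X 2 ^ 5 + X 3 ^ 5 + X 4 ^ 7 + X 5 ^ 7)
    (hF1 : F 1 = X 0 ^ 2 + C 2 * X 1 ^ 3 + X 2 ^ 10 + X 3 ^ 10 + X 4 ^ 14 + X 5 ^ 14)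
    (g : Fin 2 → MvPolynomial (Fin 6) k)
    (hg0 : g 0 = X 0 ^ 2 - (X 2 ^ 10 * X 5 ^ 8 - C 2 * (X 2 ^ 5 * X 5 ^ 3) + X 3 ^ 10 * X 5 ^ 8 - C 2 * (X 3 ^ 5 * X 5 ^ 3) + X 4 ^ 14 * X 5 ^ 12 -
      C 2 * (X 4 ^ 7 * X 5 ^ 5) + X 5 ^ 12 - C 2 * X 5 ^ 5))
    (hg1 : g 1 = X 1 ^ 3 + (X 2 ^ 10 * X 5 ^ 7 - X 2 ^ 5 * X 5 ^ 2 + X 3 ^ 10 * X 5 ^ 7 - X 3 ^ 5 * X 5 ^ 2 + X 4 ^ 14 * X 5 ^ 11 - X 4 ^ 7 * X 5 ^ 4 +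
      X 5 ^ 11 - X 5 ^ 4)) : ∀ l : Fin 2,
    aeval (fun j : Fin 6 => if j = 5 then (X 5 : MvPolynomial (Fin 6) k) else X j * X 5) (F l) ∈ Ideal.span (Set.range g) := by
  have h0 : g 0 ∈ Ideal.span (Set.range g) := Ideal.subset_span ⟨0, rfl⟩
  have h1 : g 1 ∈ Ideal.span (Set.range g) := Ideal.subset_span ⟨1, rfl⟩
  refine Fin.forall_fin_two.mpr ⟨?_, ?_⟩
  · have e : aeval (fun j : Fin 6 => if j = 5 then (X 5 : MvPolynomial (Fin 6) k) else X j * X 5) (F 0) = X 5 ^ 2 * g 0 + X 5 ^ 3 * g 1 := by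
      rw [hF0, hg0, hg1]
      simp only [map_sub, map_add, map_mul, map_pow, aeval_X, aeval_C, algebraMap_eq, Fin.reduceEq, if_true, if_false, map_ofNat, reduceIte]
      ring
    rw [e]
    exact add_mem (Ideal.mul_mem_left _ _ h0) (Ideal.mul_mem_left _ _ h1)
  · have e : aeval (fun j : Fin 6 => if j = 5 then (X 5 : MvPolynomial (Fin 6) k) else X j * X 5) (F 1) = X 5 ^ 2 * g 0 + C 2 * X 5 ^ 3 * g 1 := by
      rw [hF1, hg0, hg1]
      simp only [map_sub, map_add, map_mul, map_pow, aeval_X, aeval_C, algebraMap_eq, Fin.reduceEq, if_true, if_false, map_ofNat, reduceIte]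
      ring
    rw [e]
    exact add_mem (Ideal.mul_mem_left _ _ h0) (Ideal.mul_mem_left _ _ h1)

/-- `p₁, q₁` vanish at the chart origin. [plumbing] -/
theorem constantCoeff_g (g : Fin 2 → MvPolynomial (Fin 6) k)
    (hg0 : g 0 = X 0 ^ 2 - (X 2 ^ 10 * X 5 ^ 8 - C 2 * (X 2 ^ 5 * X 5 ^ 3) + X 3 ^ 10 * X 5 ^ 8 - C 2 * (X 3 ^ 5 * X 5 ^ 3) + X 4 ^ 14 * X 5 ^ 12 -
      C 2 * (X 4 ^ 7 * X 5 ^ 5) + X 5 ^ 12 - C 2 * X 5 ^ 5))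
    (hg1 : g 1 = X 1 ^ 3 + (X 2 ^ 10 * X 5 ^ 7 - X 2 ^ 5 * X 5 ^ 2 + X 3 ^ 10 * X 5 ^ 7 - X 3 ^ 5 * X 5 ^ 2 + X 4 ^ 14 * X 5 ^ 11 - X 4 ^ 7 * X 5 ^ 4 +
      X 5 ^ 11 - X 5 ^ 4)) : ∀ l : Fin 2, constantCoeff (g l) = 0 := by
  refine Fin.forall_fin_two.mpr ⟨?_, ?_⟩
  · rw [hg0]; simp [constantCoeff_X]
  · rw [hg1]; simp [constantCoeff_X]


/-! ## §2 The chart ideal is the monic tower `(y₀² − ιG₅, y₁³ + ιH₅)`: prime, `y₅ ∉` it -/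

/-- **No square by TRAILING degree**: if a specialisation `s : C → k[t]` sends `G` to `q ≠ 0` of odd trailing degree, `y² ≠ G` for all `y`. [elementary] -/
theorem no_square_of_spec_trailing (G : MvPolynomial (Fin 4) k) (s : MvPolynomial (Fin 4) k →+* Polynomial k) (q : Polynomial k) (hs : s G = q) (hq0 : q ≠ 0)
    (N : ℕ) (hq : q.natTrailingDegree = N) (hN : ¬ 2 ∣ N) (y : MvPolynomial (Fin 4) k) : y ^ 2 ≠ G := by
  intro h0
  have h1 := congrArg s h0
  rw [map_pow, hs] at h1
  have hy : s y ≠ 0 := fun h => hq0 (by rw [← h1, h, zero_pow two_ne_zero])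
  have h2 := congrArg Polynomial.natTrailingDegree h1
  rw [pow_two, Polynomial.natTrailingDegree_mul hy hy, hq] at h2
  exact hN ⟨_, by rw [← h2, two_mul]⟩

/-- `G₅` (in `k[y₂..y₅] = k[X 0..X 3]`) is not a square when `2 ≠ 0`: `y₅ ↦ t` gives `t¹² − 2t⁵ = (t⁷ − 2)t⁵`, trailing degree `5`. [elementary] -/
theorem no_square_G₅ (h2 : (2 : k) ≠ 0) (y : MvPolynomial (Fin 4) k) :
    y ^ 2 ≠ (X 0 ^ 10 * X 3 ^ 8 - C 2 * (X 0 ^ 5 * X 3 ^ 3) + X 1 ^ 10 * X 3 ^ 8 - C 2 * (X 1 ^ 5 * X 3 ^ 3) + X 2 ^ 14 * X 3 ^ 12 - C 2 * (X 2 ^ 7 * X 3 ^ 5) +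
      X 3 ^ 12 - C 2 * X 3 ^ 5 : MvPolynomial (Fin 4) k) := by
  have hc : (Polynomial.X ^ 7 - Polynomial.C (2 : k)) ≠ 0 := fun h => by
    have := congrArg (Polynomial.coeff · 0) h
    simp at this
    exact h2 this
  have hq0 : (Polynomial.X ^ 7 - Polynomial.C (2 : k)) * Polynomial.X ^ 5 ≠ 0 := mul_ne_zero hc (pow_ne_zero _ Polynomial.X_ne_zero)
  refine no_square_of_spec_trailing k _ (MvPolynomial.eval₂Hom (Polynomial.C : k →+* Polynomial k) (![0, 0, 0, Polynomial.X] : Fin 4 → Polynomial k))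
    ((Polynomial.X ^ 7 - Polynomial.C 2) * Polynomial.X ^ 5) ?_ hq0 5 ?_ (by norm_num) y
  · simp only [map_add, map_sub, map_mul, map_pow, MvPolynomial.eval₂Hom_X', MvPolynomial.eval₂Hom_C, Matrix.cons_val_zero, Matrix.cons_val_one, Matrix.cons_val]
    ring
  · rw [Polynomial.natTrailingDegree_mul_X_pow hc 5, Polynomial.natTrailingDegree_eq_zero_of_constantCoeff_ne_zero]
    intro h
    apply hc
    have h' : Polynomial.constantCoeff (Polynomial.X ^ 7 - Polynomial.C (2 : k)) = -2 := by simp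
    rw [h'] at h
    exact (h2 (neg_eq_zero.mp h)).elim

/-- `−H₅` is not a cube: `y₅ ↦ t` gives `t¹¹ − t⁴`, degree `11`, `3 ∤ 11`. [elementary] -/
theorem no_cube_H₅ (y : MvPolynomial (Fin 4) k) :
    y ^ 3 + (X 0 ^ 10 * X 3 ^ 7 - X 0 ^ 5 * X 3 ^ 2 + X 1 ^ 10 * X 3 ^ 7 - X 1 ^ 5 * X 3 ^ 2 + X 2 ^ 14 * X 3 ^ 11 - X 2 ^ 7 * X 3 ^ 4 + X 3 ^ 11 - X 3 ^ 4 :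
      MvPolynomial (Fin 4) k) ≠ 0 := by
  refine DiagonalBPCIChartsCM.no_cube_of_spec k _ (MvPolynomial.eval₂Hom (Polynomial.C : k →+* Polynomial k) (![0, 0, 0, Polynomial.X] : Fin 4 → Polynomial k))
    (Polynomial.X ^ 11 - Polynomial.X ^ 4) ?_ 11 ?_ (by norm_num) y
  · simp only [map_add, map_sub, map_mul, map_pow, MvPolynomial.eval₂Hom_X', Matrix.cons_val_zero, Matrix.cons_val_one, Matrix.cons_val]
    ring
  · rw [Polynomial.natDegree_sub_eq_left_of_natDegree_lt] <;> simp

/-- ★ **THE CHART IDEAL `J₅ = (p₁, q₁)` IS PRIME AND `y₅ ∉ J₅`** (`2 ≠ 0`): the monic tower `(y₀² − ιG₅, y₁³ + ιH₅)` (✓`TowerBedChartCM.isPrime_pair` over ✓`MonicTowerPrime`). [OURS · certificate] -/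
theorem isPrime_chart5 (h2 : (2 : k) ≠ 0) (g : Fin 2 → MvPolynomial (Fin 6) k)
    (hg0 : g 0 = X 0 ^ 2 - (X 2 ^ 10 * X 5 ^ 8 - C 2 * (X 2 ^ 5 * X 5 ^ 3) + X 3 ^ 10 * X 5 ^ 8 - C 2 * (X 3 ^ 5 * X 5 ^ 3) + X 4 ^ 14 * X 5 ^ 12 -
      C 2 * (X 4 ^ 7 * X 5 ^ 5) + X 5 ^ 12 - C 2 * X 5 ^ 5))
    (hg1 : g 1 = X 1 ^ 3 + (X 2 ^ 10 * X 5 ^ 7 - X 2 ^ 5 * X 5 ^ 2 + X 3 ^ 10 * X 5 ^ 7 - X 3 ^ 5 * X 5 ^ 2 + X 4 ^ 14 * X 5 ^ 11 - X 4 ^ 7 * X 5 ^ 4 +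
      X 5 ^ 11 - X 5 ^ 4)) :
    (Ideal.span (Set.range g)).IsPrime ∧ (X 5 : MvPolynomial (Fin 6) k) ∉ Ideal.span (Set.range g) := by
  refine TowerBedChartCM.isPrime_pair k _ _ (no_square_G₅ k h2) (no_cube_H₅ k) g ?_ ?_ 5 3 rfl
  · rw [hg0]
    simp only [map_add, map_sub, map_mul, map_pow, MvPolynomial.eval₂Hom_X', MvPolynomial.eval₂Hom_C, Matrix.cons_val_zero, Matrix.cons_val_one, Matrix.cons_val]
  · rw [hg1]
    simp only [map_add, map_sub, map_mul, map_pow, MvPolynomial.eval₂Hom_X', Matrix.cons_val_zero, Matrix.cons_val_one, Matrix.cons_val]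

/-! ## §3 The minimal-weight toolkit; the p-uniform CI Fedder certificate and the s.o.p. certificate at the chart origin -/

/-- Lower weight bounds pass to products. [folklore] -/
theorem le_weight_of_mem_support_mul {n : ℕ} (w : Fin n → ℕ) (φ ψ : MvPolynomial (Fin n) k) (D₁ D₂ : ℕ)
    (h₁ : ∀ m ∈ φ.support, D₁ ≤ Finsupp.weight w m) (h₂ : ∀ m ∈ ψ.support, D₂ ≤ Finsupp.weight w m) :
    ∀ m ∈ (φ * ψ).support, D₁ + D₂ ≤ Finsupp.weight w m := by
  classical
  intro m hm
  obtain ⟨m₁, hm₁, m₂, hm₂, rfl⟩ := Finset.mem_add.mp (support_mul φ ψ hm)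
  rw [map_add]
  exact add_le_add (h₁ m₁ hm₁) (h₂ m₂ hm₂)

/-- Lower weight bounds pass to powers. [folklore] -/
theorem le_weight_of_mem_support_pow {n : ℕ} (w : Fin n → ℕ) (φ : MvPolynomial (Fin n) k) (D : ℕ) (h : ∀ m ∈ φ.support, D ≤ Finsupp.weight w m) :
    ∀ (e : ℕ), ∀ m ∈ (φ ^ e).support, e * D ≤ Finsupp.weight w m := by
  classical
  intro e
  induction e with
  | zero => intro m _; simp
  | succ e ih =>
    intro m hm
    rw [pow_succ] at hm
    have := le_weight_of_mem_support_mul k w (φ ^ e) φ (e * D) D ih h m hm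
    rw [Nat.succ_mul]
    exact this

/-- A polynomial all of whose monomials have weight `> (p − 1)·Σwᵢ` lies in `(xᵢ^p : i)`. [folklore] -/
theorem mem_span_X_pow_of_le_weight {n : ℕ} (p : ℕ) (w : Fin n → ℕ) (φ : MvPolynomial (Fin n) k) (D : ℕ)
    (hφ : ∀ m ∈ φ.support, D ≤ Finsupp.weight w m) (hD : (p - 1) * ∑ i, w i < D) :
    φ ∈ Ideal.span (Set.range fun i : Fin n => (X i : MvPolynomial (Fin n) k) ^ p) := by
  rw [DoublePointFedder.mem_span_X_pow_iff]
  intro m hm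
  by_contra hcon
  simp only [not_exists, not_le] at hcon
  have hle : Finsupp.weight w m ≤ (p - 1) * ∑ i, w i := by
    rw [Finsupp.weight_apply, Finsupp.sum_fintype _ _ (fun i => by simp), Finset.mul_sum]
    exact Finset.sum_le_sum fun i _ => by rw [smul_eq_mul]; exact Nat.mul_le_mul_right _ (by have := hcon i; omega)
  exact absurd (lt_of_le_of_lt hle hD) (not_lt.mpr (hφ m hm))

/-- Every monomial of a diagonal `Σ cᵢxᵢ^{eᵢ}` has weight `≥ D` if all `eᵢwᵢ ≥ D`. [folklore] -/
theorem le_weight_of_mem_support_diag {n : ℕ} (w : Fin n → ℕ) (e : Fin n → ℕ) (c : Fin n → k) (D : ℕ) (hD : ∀ i, D ≤ e i * w i) :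
    ∀ m ∈ (∑ i : Fin n, monomial (Finsupp.single i (e i)) (c i)).support, D ≤ Finsupp.weight w m := by
  intro m hm
  obtain ⟨i, rfl⟩ := DiagonalCIPair.exists_eq_single_of_mem_support e c m hm
  rw [Finsupp.weight_single, smul_eq_mul]
  exact hD i

section Weights

variable {n : ℕ} (w : Fin n → ℕ)

/-- Weight lower bound for `X i ^ a`. [plumbing] -/
theorem wge_X_pow (D : ℕ) (i : Fin n) (a : ℕ) (h : D ≤ a * w i) :
    ∀ m ∈ ((X i : MvPolynomial (Fin n) k) ^ a).support, D ≤ Finsupp.weight w m := by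
  classical
  intro m hm
  rw [X_pow_eq_monomial] at hm
  rw [Finset.mem_singleton.mp (support_monomial_subset hm), Finsupp.weight_single, smul_eq_mul]
  exact h

/-- Weight lower bound for `X i ^ a * X j ^ b`. [plumbing] -/
theorem wge_X_pow_mul (D : ℕ) (i j : Fin n) (a b : ℕ) (h : D ≤ a * w i + b * w j) :
    ∀ m ∈ ((X i : MvPolynomial (Fin n) k) ^ a * X j ^ b).support, D ≤ Finsupp.weight w m := by
  intro m hm
  have := le_weight_of_mem_support_mul k w _ _ _ _ (wge_X_pow k w (a * w i) i a le_rfl) (wge_X_pow k w (b * w j) j b le_rfl) m hm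
  omega

/-- Weight lower bounds survive multiplication by a constant. [plumbing] -/
theorem wge_C_mul (D : ℕ) (c : k) (φ : MvPolynomial (Fin n) k) (h : ∀ m ∈ φ.support, D ≤ Finsupp.weight w m) :
    ∀ m ∈ (C c * φ).support, D ≤ Finsupp.weight w m := by
  intro m hm
  rw [C_mul'] at hm
  exact h m (support_smul hm)

/-- Weight lower bounds survive sums. [plumbing] -/
theorem wge_add (D : ℕ) (φ ψ : MvPolynomial (Fin n) k) (h₁ : ∀ m ∈ φ.support, D ≤ Finsupp.weight w m) (h₂ : ∀ m ∈ ψ.support, D ≤ Finsupp.weight w m) :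
    ∀ m ∈ (φ + ψ).support, D ≤ Finsupp.weight w m := by
  classical
  intro m hm
  rcases Finset.mem_union.mp (support_add hm) with h | h
  · exact h₁ m h
  · exact h₂ m h

/-- Weight lower bounds survive differences. [plumbing] -/
theorem wge_sub (D : ℕ) (φ ψ : MvPolynomial (Fin n) k) (h₁ : ∀ m ∈ φ.support, D ≤ Finsupp.weight w m) (h₂ : ∀ m ∈ ψ.support, D ≤ Finsupp.weight w m) :
    ∀ m ∈ (φ - ψ).support, D ≤ Finsupp.weight w m := by
  classical
  rw [sub_eq_add_neg]
  refine wge_add k w D φ (-ψ) h₁ fun m hm => h₂ m ?_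
  rwa [support_neg] at hm

end Weights


/-- Every monomial of `p₁` has `u`-weight `≥ 30`, `u = (15, 8, 3, 3, 0, 6)`. [certificate] -/
theorem wge_p₁ (g : Fin 2 → MvPolynomial (Fin 6) k)
    (hg0 : g 0 = X 0 ^ 2 - (X 2 ^ 10 * X 5 ^ 8 - C 2 * (X 2 ^ 5 * X 5 ^ 3) + X 3 ^ 10 * X 5 ^ 8 - C 2 * (X 3 ^ 5 * X 5 ^ 3) + X 4 ^ 14 * X 5 ^ 12 -
      C 2 * (X 4 ^ 7 * X 5 ^ 5) + X 5 ^ 12 - C 2 * X 5 ^ 5)) : ∀ m ∈ (g 0).support, 30 ≤ Finsupp.weight (![15, 8, 3, 3, 0, 6] : Fin 6 → ℕ) m := by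
  rw [hg0]
  refine wge_sub k _ 30 _ _ (wge_X_pow k _ 30 0 2 (by simp)) ?_
  refine wge_sub k _ 30 _ _ ?_ (wge_C_mul k _ 30 2 _ (wge_X_pow k _ 30 5 5 (by simp)))
  refine wge_add k _ 30 _ _ ?_ (wge_X_pow k _ 30 5 12 (by simp))
  refine wge_sub k _ 30 _ _ ?_ (wge_C_mul k _ 30 2 _ (wge_X_pow_mul k _ 30 4 5 7 5 (by simp)))
  refine wge_add k _ 30 _ _ ?_ (wge_X_pow_mul k _ 30 4 5 14 12 (by simp))
  refine wge_sub k _ 30 _ _ ?_ (wge_C_mul k _ 30 2 _ (wge_X_pow_mul k _ 30 3 5 5 3 (by simp)))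
  refine wge_add k _ 30 _ _ ?_ (wge_X_pow_mul k _ 30 3 5 10 8 (by simp))
  refine wge_sub k _ 30 _ _ ?_ (wge_C_mul k _ 30 2 _ (wge_X_pow_mul k _ 30 2 5 5 3 (by simp)))
  exact wge_X_pow_mul k _ 30 2 5 10 8 (by simp)

/-- Every monomial of `q₁` has `u`-weight `≥ 24`. [certificate] -/
theorem wge_q₁ (g : Fin 2 → MvPolynomial (Fin 6) k)
    (hg1 : g 1 = X 1 ^ 3 + (X 2 ^ 10 * X 5 ^ 7 - X 2 ^ 5 * X 5 ^ 2 + X 3 ^ 10 * X 5 ^ 7 - X 3 ^ 5 * X 5 ^ 2 + X 4 ^ 14 * X 5 ^ 11 - X 4 ^ 7 * X 5 ^ 4 +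
      X 5 ^ 11 - X 5 ^ 4)) : ∀ m ∈ (g 1).support, 24 ≤ Finsupp.weight (![15, 8, 3, 3, 0, 6] : Fin 6 → ℕ) m := by
  rw [hg1]
  refine wge_add k _ 24 _ _ (wge_X_pow k _ 24 1 3 (by simp)) ?_
  refine wge_sub k _ 24 _ _ ?_ (wge_X_pow k _ 24 5 4 (by simp))
  refine wge_add k _ 24 _ _ ?_ (wge_X_pow k _ 24 5 11 (by simp))
  refine wge_sub k _ 24 _ _ ?_ (wge_X_pow_mul k _ 24 4 5 7 4 (by simp))
  refine wge_add k _ 24 _ _ ?_ (wge_X_pow_mul k _ 24 4 5 14 11 (by simp))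
  refine wge_sub k _ 24 _ _ ?_ (wge_X_pow_mul k _ 24 3 5 5 2 (by simp))
  refine wge_add k _ 24 _ _ ?_ (wge_X_pow_mul k _ 24 3 5 10 7 (by simp))
  refine wge_sub k _ 24 _ _ ?_ (wge_X_pow_mul k _ 24 2 5 5 2 (by simp))
  exact wge_X_pow_mul k _ 24 2 5 10 7 (by simp)

/-- ★ **THE p-UNIFORM CI FEDDER CERTIFICATE AT THE CHART ORIGIN**: `(p₁q₁)^{p−1} ∈ (y₀^p, …, y₅^p)` for EVERY `p ≥ 2` (`54(p−1) > 35(p−1)`). [OURS · certificate; cite: Fedder1983,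
Prop. 2.1] -/
theorem prod_pow_mem_span_X_pow_chart5 (g : Fin 2 → MvPolynomial (Fin 6) k)
    (hg0 : g 0 = X 0 ^ 2 - (X 2 ^ 10 * X 5 ^ 8 - C 2 * (X 2 ^ 5 * X 5 ^ 3) + X 3 ^ 10 * X 5 ^ 8 - C 2 * (X 3 ^ 5 * X 5 ^ 3) + X 4 ^ 14 * X 5 ^ 12 -
      C 2 * (X 4 ^ 7 * X 5 ^ 5) + X 5 ^ 12 - C 2 * X 5 ^ 5))
    (hg1 : g 1 = X 1 ^ 3 + (X 2 ^ 10 * X 5 ^ 7 - X 2 ^ 5 * X 5 ^ 2 + X 3 ^ 10 * X 5 ^ 7 - X 3 ^ 5 * X 5 ^ 2 + X 4 ^ 14 * X 5 ^ 11 - X 4 ^ 7 * X 5 ^ 4 +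
      X 5 ^ 11 - X 5 ^ 4)) (p : ℕ) (hp : 2 ≤ p) :
    (∏ l, g l) ^ (p - 1) ∈ Ideal.span (Set.range fun i : Fin 6 => (X i : MvPolynomial (Fin 6) k) ^ p) := by
  rw [Fin.prod_univ_two]
  have hprod := le_weight_of_mem_support_pow k _ (g 0 * g 1) 54
    (le_weight_of_mem_support_mul k _ (g 0) (g 1) 30 24 (wge_p₁ k g hg0) (wge_q₁ k g hg1)) (p - 1)
  refine mem_span_X_pow_of_le_weight k p _ _ ((p - 1) * 54) hprod ?_
  have hsum : ∑ i : Fin 6, (![15, 8, 3, 3, 0, 6] : Fin 6 → ℕ) i = 35 := by decide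
  rw [hsum]
  have : 1 ≤ p - 1 := by omega
  nlinarith

/-- ★ **THE S.O.P. CERTIFICATE AT THE CHART ORIGIN**: `(y₀, …, y₅)⁴ ⊆ (p₁, q₁, y₂, y₃, y₄, y₅)` (`y₀² ≡ p₁`, `y₁³ ≡ q₁` modulo `(y₅)`). [OURS · certificate; folklore] -/
theorem sop_certificate_chart5 (g : Fin 2 → MvPolynomial (Fin 6) k)
    (hg0 : g 0 = X 0 ^ 2 - (X 2 ^ 10 * X 5 ^ 8 - C 2 * (X 2 ^ 5 * X 5 ^ 3) + X 3 ^ 10 * X 5 ^ 8 - C 2 * (X 3 ^ 5 * X 5 ^ 3) + X 4 ^ 14 * X 5 ^ 12 -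
      C 2 * (X 4 ^ 7 * X 5 ^ 5) + X 5 ^ 12 - C 2 * X 5 ^ 5))
    (hg1 : g 1 = X 1 ^ 3 + (X 2 ^ 10 * X 5 ^ 7 - X 2 ^ 5 * X 5 ^ 2 + X 3 ^ 10 * X 5 ^ 7 - X 3 ^ 5 * X 5 ^ 2 + X 4 ^ 14 * X 5 ^ 11 - X 4 ^ 7 * X 5 ^ 4 +
      X 5 ^ 11 - X 5 ^ 4)) :
    Ideal.span (Set.range (X : Fin 6 → MvPolynomial (Fin 6) k)) ^ 4 ≤ Ideal.ofList (List.ofFn g ++ [X 2, X 3, X 4, X 5]) := by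
  set J : Ideal (MvPolynomial (Fin 6) k) := Ideal.ofList (List.ofFn g ++ [X 2, X 3, X 4, X 5]) with hJ
  have hmem : ∀ x ∈ List.ofFn g ++ [X 2, X 3, X 4, X 5], x ∈ J := fun x hx => Ideal.subset_span hx
  have hg0J : g 0 ∈ J := hmem _ (List.mem_append.mpr (Or.inl ((List.mem_ofFn' _ _).mpr ⟨0, rfl⟩)))
  have hg1J : g 1 ∈ J := hmem _ (List.mem_append.mpr (Or.inl ((List.mem_ofFn' _ _).mpr ⟨1, rfl⟩)))
  have hX2 : (X 2 : MvPolynomial (Fin 6) k) ∈ J := hmem _ (by simp)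
  have hX3 : (X 3 : MvPolynomial (Fin 6) k) ∈ J := hmem _ (by simp)
  have hX4 : (X 4 : MvPolynomial (Fin 6) k) ∈ J := hmem _ (by simp)
  have hX5 : (X 5 : MvPolynomial (Fin 6) k) ∈ J := hmem _ (by simp)
  have hX0 : (X 0 : MvPolynomial (Fin 6) k) ^ 2 ∈ J := by
    have e : (X 0 : MvPolynomial (Fin 6) k) ^ 2 = g 0 + (X 2 ^ 10 * X 5 ^ 7 - C 2 * (X 2 ^ 5 * X 5 ^ 2) + X 3 ^ 10 * X 5 ^ 7 - C 2 * (X 3 ^ 5 * X 5 ^ 2) +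
        X 4 ^ 14 * X 5 ^ 11 - C 2 * (X 4 ^ 7 * X 5 ^ 4) + X 5 ^ 11 - C 2 * X 5 ^ 4) * X 5 := by
      rw [hg0]; ring
    rw [e]
    exact add_mem hg0J (J.mul_mem_left _ hX5)
  have hX1 : (X 1 : MvPolynomial (Fin 6) k) ^ 3 ∈ J := by
    have e : (X 1 : MvPolynomial (Fin 6) k) ^ 3 = g 1 - (X 2 ^ 10 * X 5 ^ 6 - X 2 ^ 5 * X 5 + X 3 ^ 10 * X 5 ^ 6 - X 3 ^ 5 * X 5 + X 4 ^ 14 * X 5 ^ 10 -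
        X 4 ^ 7 * X 5 ^ 3 + X 5 ^ 10 - X 5 ^ 3) * X 5 := by
      rw [hg1]; ring
    rw [e]
    exact sub_mem hg1J (J.mul_mem_left _ hX5)
  -- every monomial of degree 4 lies in `J`
  rw [show Ideal.span (Set.range (X : Fin 6 → MvPolynomial (Fin 6) k)) = idealOfVars (Fin 6) k from rfl, pow_idealOfVars_eq_span,
    Ideal.span_le]
  rintro _ ⟨m, hm, rfl⟩
  rw [Set.mem_preimage, Set.mem_singleton_iff, Finsupp.degree_eq_sum, Fin.sum_univ_six] at hm
  change monomial m (1 : k) ∈ J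
  by_cases h2 : 1 ≤ m 2
  · exact DiagonalBPCIVertexNotFull.monomial_mem_of_le k 2 1 m h2 (by rw [pow_one]; exact hX2)
  by_cases h3 : 1 ≤ m 3
  · exact DiagonalBPCIVertexNotFull.monomial_mem_of_le k 3 1 m h3 (by rw [pow_one]; exact hX3)
  by_cases h4 : 1 ≤ m 4
  · exact DiagonalBPCIVertexNotFull.monomial_mem_of_le k 4 1 m h4 (by rw [pow_one]; exact hX4)
  by_cases h5 : 1 ≤ m 5
  · exact DiagonalBPCIVertexNotFull.monomial_mem_of_le k 5 1 m h5 (by rw [pow_one]; exact hX5)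
  by_cases h0 : 2 ≤ m 0
  · exact DiagonalBPCIVertexNotFull.monomial_mem_of_le k 0 2 m h0 hX0
  · exact DiagonalBPCIVertexNotFull.monomial_mem_of_le k 1 3 m (by omega) hX1


/-! ## §4 ★★ The floor NOT-FULL column of ROW #13 -/


/-- Both generators of BED CI-3 vanish at the origin. [plumbing] -/
theorem constantCoeff_F (F : Fin 2 → MvPolynomial (Fin 6) k)
    (hF0 : F 0 = X 0 ^ 2 + X 1 ^ 3 + X 2 ^ 5 + X 3 ^ 5 + X 4 ^ 7 + X 5 ^ 7)
    (hF1 : F 1 = X 0 ^ 2 + C 2 * X 1 ^ 3 + X 2 ^ 10 + X 3 ^ 10 + X 4 ^ 14 + X 5 ^ 14) : ∀ l : Fin 2, constantCoeff (F l) = 0 := by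
  refine Fin.forall_fin_two.mpr ⟨?_, ?_⟩
  · rw [hF0]; simp [constantCoeff_X]
  · rw [hF1]; simp [constantCoeff_X]

/-- ★★ **BED CI-3, FLOOR NOT-FULL COLUMN**: `X = V(x₀²+x₁³+x₂⁵+x₃⁵+x₄⁷+x₅⁷, x₀²+2x₁³+x₂¹⁰+x₃¹⁰+x₄¹⁴+x₅¹⁴) ⊂ 𝔸⁶`, `k` ANY field of characteristic `p ≠ 2`, `v` the vertex: for EVERY blowing up
`g : S′ → Spec 𝒪_{X,v}` along the point floor there is a point `s ∈ S′` over the closed point whose local ring is NOT `FullCl p` (the origin of the `x₅`-chart `Spec k[y]/(p₁, q₁)` of `Bl_𝔪 X`,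
a complete intersection failing the CI Fedder test p-uniformly). ONE application of ✓`PointFloorNotFullCI.pointFloor_not_full`. [OURS · census certificate (floor NOT-FULL side of ROW #13);
cite: Fedder1983, Thm. 1.12 and Prop. 2.1; GortzWedhorn2020, Prop. 13.91 (2)] -/
theorem twoRatioBP_pointFloor_not_full (p : ℕ) [Fact p.Prime] (k : Type) [Field k] [CharP k p] (h2 : (2 : k) ≠ 0)
    (F : Fin 2 → MvPolynomial (Fin 6) k)
    (hF0 : F 0 = X 0 ^ 2 + X 1 ^ 3 + X 2 ^ 5 + X 3 ^ 5 + X 4 ^ 7 + X 5 ^ 7)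
    (hF1 : F 1 = X 0 ^ 2 + C 2 * X 1 ^ 3 + X 2 ^ 10 + X 3 ^ 10 + X 4 ^ 14 + X 5 ^ 14)
    (v : Spec (.of (MvPolynomial (Fin 6) k ⧸ Ideal.span (Set.range F))))
    (hvm : v.asIdeal = Ideal.span (Set.range fun j : Fin 6 => Ideal.Quotient.mk (Ideal.span (Set.range F)) (X j)))
    (S' : Scheme.{0}) (g' : S' ⟶ Spec ((Spec (.of (MvPolynomial (Fin 6) k ⧸ Ideal.span (Set.range F)))).presheaf.stalk v))
    (hg' : IsBlowup g' ((affineBlowup.idealSheaf (Ideal.span (Set.range fun j : Fin 6 => Ideal.Quotient.mk (Ideal.span (Set.range F)) (X j)))).comap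
      ((Spec (.of (MvPolynomial (Fin 6) k ⧸ Ideal.span (Set.range F)))).fromSpecStalk v))) :
    ∃ s : S', g'.base s = closedPoint ((Spec (.of (MvPolynomial (Fin 6) k ⧸ Ideal.span (Set.range F)))).presheaf.stalk v) ∧ ¬ FullCl p (S'.presheaf.stalk s) := by
  obtain ⟨g, hg⟩ : ∃ g : Fin 2 → MvPolynomial (Fin 6) k, g = ![X 0 ^ 2 - (X 2 ^ 10 * X 5 ^ 8 - C 2 * (X 2 ^ 5 * X 5 ^ 3) + X 3 ^ 10 * X 5 ^ 8 -
      C 2 * (X 3 ^ 5 * X 5 ^ 3) + X 4 ^ 14 * X 5 ^ 12 - C 2 * (X 4 ^ 7 * X 5 ^ 5) + X 5 ^ 12 - C 2 * X 5 ^ 5),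
      X 1 ^ 3 + (X 2 ^ 10 * X 5 ^ 7 - X 2 ^ 5 * X 5 ^ 2 + X 3 ^ 10 * X 5 ^ 7 - X 3 ^ 5 * X 5 ^ 2 + X 4 ^ 14 * X 5 ^ 11 - X 4 ^ 7 * X 5 ^ 4 + X 5 ^ 11 - X 5 ^ 4)] :=
    ⟨_, rfl⟩
  have hg0 : g 0 = X 0 ^ 2 - (X 2 ^ 10 * X 5 ^ 8 - C 2 * (X 2 ^ 5 * X 5 ^ 3) + X 3 ^ 10 * X 5 ^ 8 - C 2 * (X 3 ^ 5 * X 5 ^ 3) + X 4 ^ 14 * X 5 ^ 12 -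
      C 2 * (X 4 ^ 7 * X 5 ^ 5) + X 5 ^ 12 - C 2 * X 5 ^ 5) := by rw [hg]; rfl
  have hg1 : g 1 = X 1 ^ 3 + (X 2 ^ 10 * X 5 ^ 7 - X 2 ^ 5 * X 5 ^ 2 + X 3 ^ 10 * X 5 ^ 7 - X 3 ^ 5 * X 5 ^ 2 + X 4 ^ 14 * X 5 ^ 11 - X 4 ^ 7 * X 5 ^ 4 +
      X 5 ^ 11 - X 5 ^ 4) := by rw [hg]; rfl
  obtain ⟨hJ, hX5⟩ := isPrime_chart5 k h2 g hg0 hg1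
  exact PointFloorNotFullCI.pointFloor_not_full p k F (constantCoeff_F k F hF0 hF1) 5 ![C 2 * F 0 - F 1, F 1 - F 0]
    (DiagonalBPCIChart5NotFull.PQ_mem k F) g ![2, 3] (theta_PQ k F hF0 hF1 g hg0 hg1) (theta_F_mem k F hF0 hF1 g hg0 hg1) hJ hX5 (constantCoeff_g k g hg0 hg1)
    (prod_pow_mem_span_X_pow_chart5 k g hg0 hg1 p (Fact.out : p.Prime).two_le) [X 2, X 3, X 4, X 5] (by simp [constantCoeff_X]) rfl 4
    (sop_certificate_chart5 k g hg0 hg1) v hvm S' g' hg'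

end Summit.ResolutionOfSingularities.ResolutionOfSingularities.Theorems.FInjectiveMacaulayfication.TwoRatioBPChart5NotFull

end
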